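import Summits.CriticalPhenomena.CardyFormulaZ2.Theorems.CardyMagicRigidityPinchResamplingDefsV3
import Literature.Probability.Percolation.SitePercolationMeasure
import HarnessLib

/-!
# Good-event counting shell: `#boxes · π₆ → 0` from the five-arm upper bound

Crux `Summit.CriticalPhenomena.CardyFormulaZ2.Theses.CardyMagicRigidity.NestingRigidity`
(stmt-CriticalPhenomena-4835), line `pinch-resampling` v3, brick B7 of the transfer stub S10 `stub_neckTomography`.

The good events G1 ("no neck region crossed by three macroscopic strands") and G2 ("no `ε`-shadows") of the transfer
(audit `S4-audit.md` §2.G; skeleton docstring of `stub_neckTomography`) are complements of finite unions of TRANSLATES of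
one six-arm event `armEvent (T,F,T,F,F,T) m n` over the `r`-boxes of the window, and their failure probability is bounded
by the union bound `#boxes · π₆(m, n)`, where `#boxes ≤ K (n/m)²` (boxes of size `m = r/δ` in a window of size `≍ n = θ/δ`
up to the `η`-dependent constant `K`) and `π₆(m, n) ≤ C (m/n)² (m/n)^α` (`sixArm_le_of_fiveArmUpperT`, DefsV3, from the
stub hypothesis `FiveArmUpperT`, Reimer and the one-arm bound): the product is `K C (m/n)^α → 0` as `r/θ → 0` — the
exponent `2` of the five-arm bound exactly cancels the box count, and only the one-arm excess `α` is spent.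

* §1 measure theory only: `measureReal_biUnion_le_card_mul` (union bound with a common bound) and the counting shell
  `measureReal_biUnion_le_of_card_le` (`card ≤ K (n/m)²`, each event `≤ C (m/n)² (m/n)^α` ⟹ union `≤ K C (m/n)^α`).
* §2 site percolation on `𝕋`: translates `SiteConfig.relabel (Equiv.subRight x) ⁻¹' A` have the probability of `A`
  (`sitePercolation_real_preimage_relabel`), so `real_biUnion_translate_le`; and the registered anchor
  `sixArm_boxes_le_of_fiveArmUpperT`: under `FiveArmUpperT`, for every `K ≥ 0`, `m₀ ≤ m ≤ n` and every finite set `S` of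
  centres with `|S| ≤ K (n/m)²`, `P_{1/2}(⋃_{x ∈ S} (six arms around x from m to n)) ≤ K C (m/n)^α`.
The `ℤ²` twin needs the cluster-form six-arm event and its Reimer step from `FiveArmUpperZ2` (not yet in the tree); §1
is lattice-free and serves it verbatim.
-/

noncomputable section

namespace Summit.CriticalPhenomena.CardyFormulaZ2.Cruxes.NestingRigidity.PinchResampling

open MeasureTheory Set Literature.Probability.Percolation Literature.Probability.LatticeModels

/-! ## §1 The union-bound shell (measure theory only) -/

section Shell

variable {Ω ι : Type*} [MeasurableSpace Ω]

/-- **Union bound with a common bound**: finitely many events each of probability `≤ p` have a union of probability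
`≤ (number of events) · p`. -/
theorem measureReal_biUnion_le_card_mul (μ : Measure Ω) (s : Finset ι) (A : ι → Set Ω) {p : ℝ}
    (h : ∀ i ∈ s, μ.real (A i) ≤ p) : μ.real (⋃ i ∈ s, A i) ≤ s.card * p :=
  (measureReal_biUnion_finset_le s A).trans ((Finset.sum_le_card_nsmul s _ p h).trans_eq (nsmul_eq_mul _ _))

/-- **The counting shell of the good events**: if the number of events is `≤ K (n/m)²` and each has probability
`≤ C (m/n)² (m/n)^α` (`C ≥ 0`, `0 < m ≤ n`… only `m, n ≠ 0` is used), the union has probability `≤ K C (m/n)^α` — the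
box count cancels the exponent `2`, the excess `α` survives. -/
theorem measureReal_biUnion_le_of_card_le (μ : Measure Ω) (s : Finset ι) (A : ι → Set Ω) {K C α : ℝ} {m n : ℕ}
    (hC : 0 ≤ C) (hm : m ≠ 0) (hn : n ≠ 0) (hcard : (s.card : ℝ) ≤ K * ((n : ℝ) / m) ^ 2)
    (h : ∀ i ∈ s, μ.real (A i) ≤ C * (((m : ℝ) / n) ^ 2 * ((m : ℝ) / n) ^ α)) :
    μ.real (⋃ i ∈ s, A i) ≤ K * C * ((m : ℝ) / n) ^ α := by
  have hm' : (m : ℝ) ≠ 0 := Nat.cast_ne_zero.2 hm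
  have hn' : (n : ℝ) ≠ 0 := Nat.cast_ne_zero.2 hn
  have hX : 0 ≤ C * (((m : ℝ) / n) ^ 2 * ((m : ℝ) / n) ^ α) := by positivity
  calc μ.real (⋃ i ∈ s, A i) ≤ s.card * (C * (((m : ℝ) / n) ^ 2 * ((m : ℝ) / n) ^ α)) :=
        measureReal_biUnion_le_card_mul μ s A h
    _ ≤ K * ((n : ℝ) / m) ^ 2 * (C * (((m : ℝ) / n) ^ 2 * ((m : ℝ) / n) ^ α)) :=
        mul_le_mul_of_nonneg_right hcard hX
    _ = K * C * ((m : ℝ) / n) ^ α * (((n : ℝ) / m) * ((m : ℝ) / n)) ^ 2 := by ring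
    _ = K * C * ((m : ℝ) / n) ^ α := by rw [div_mul_div_cancel₀ hm', div_self hn', one_pow, mul_one]

end Shell

/-! ## §2 Site percolation on `𝕋`: translates, and the six-arm count under `FiveArmUpperT` -/

section SiteT

/-- **Translates of an event are equally likely** under `triSitePercolation p` (relabelling the sites by a translation
preserves the product measure, `sitePercolation_real_preimage_relabel`), hence the union of the translates of `A` over a
finite set `S` of lattice vectors has probability `≤ |S| · P(A)`. -/
theorem real_biUnion_translate_le (p : unitInterval) (A : Set (SiteConfig (Site 2))) (S : Finset (Site 2)) :
    (triSitePercolation p).real (⋃ x ∈ S, SiteConfig.relabel (Equiv.subRight x) ⁻¹' A) ≤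
      S.card * (triSitePercolation p).real A :=
  measureReal_biUnion_le_card_mul _ S _ fun x _ ↦ (sitePercolation_real_preimage_relabel (Equiv.subRight x) p A).le

/-- **Six-arm boxes under the five-arm upper bound (registered anchor; G1/G2 counting on `𝕋`).**  Assume `FiveArmUpperT`.
There are `C ≥ 0`, `α > 0` and `m₀` such that for every `K ≥ 0`, all `m₀ ≤ m ≤ n` and every finite set `S` of centres
with `|S| ≤ K (n/m)²`, the probability that the six-arm event `armEvent (T,F,T,F,F,T) m n` (order-free: it contains every
cyclic arrangement of three open and three closed arms, in particular three interface strands crossing the annulus) occurs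
around SOME centre of `S` is `≤ K C (m/n)^α`.  With `m = r/δ`, `n = θ/δ`, `S` = the `r`-boxes of the window
(`|S| ≤ K(η) (θ/r)²`), this is `P(G1 fails) ≤ K(η) C (r/θ)^α → 0` as `r → 0`, uniformly in `δ` — no rate is spent beyond the
one-arm excess `α` (`sixArm_le_of_fiveArmUpperT`: Reimer `π₆ ≤ π₅ π₁` and `exists_polyArmProb_one_le_rpow`). -/
theorem sixArm_boxes_le_of_fiveArmUpperT : Summit.CriticalPhenomena.CardyFormulaZ2.Cruxes.NestingRigidity.PinchResampling.FiveArmUpperT → ∃ C α : ℝ, ∃ m₀ : ℕ, 0 ≤ C ∧ 0 < α ∧ ∀ K : ℝ, 0 ≤ K → ∀ m n : ℕ, m₀ ≤ m → m ≤ n → ∀ S : Finset (Literature.Probability.LatticeModels.Site 2), (S.card : ℝ) ≤ K * ((n : ℝ) / m) ^ 2 → (Literature.Probability.LatticeModels.triSitePercolation Literature.Probability.Percolation.half).real (⋃ x ∈ S, Literature.Probability.Percolation.SiteConfig.relabel (Equiv.subRight x) ⁻¹' Literature.Probability.Percolation.armEvent ![true, false, true, false, false, true] m n) ≤ K * C *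 ((m : ℝ) / n) ^ α := by
  intro h5
  obtain ⟨C, α, m₀, hα, h6⟩ := sixArm_le_of_fiveArmUpperT h5
  refine ⟨max C 0, α, max m₀ 1, le_max_right _ _, hα, fun K _ m n hm hmn S hS ↦ ?_⟩
  have hm1 : 1 ≤ m := le_of_max_le_right hm
  have hm0 : m ≠ 0 := Nat.one_le_iff_ne_zero.1 hm1
  have hn0 : n ≠ 0 := Nat.one_le_iff_ne_zero.1 (hm1.trans hmn)
  refine measureReal_biUnion_le_of_card_le _ S _ (le_max_right _ _) hm0 hn0 hS fun x _ ↦ ?_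
  have hx : (triSitePercolation half).real
      (SiteConfig.relabel (Equiv.subRight x) ⁻¹' armEvent ![true, false, true, false, false, true] m n) =
      (triSitePercolation half).real (armEvent ![true, false, true, false, false, true] m n) :=
    sitePercolation_real_preimage_relabel (Equiv.subRight x) half _
  rw [hx]
  exact (h6 m n (le_of_max_le_left hm) hmn).trans
    (mul_le_mul_of_nonneg_right (le_max_left _ _) (by positivity))

end SiteT

end Summit.CriticalPhenomena.CardyFormulaZ2.Cruxes.NestingRigidity.PinchResampling

end
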